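import Summits.ResolutionOfSingularities.ResolutionOfSingularities.Theses.PAlteration
import Literature.AlgebraicGeometry.Resolution.AbsoluteIntegralClosureNoResolution
import Literature.AlgebraicGeometry.Resolution.ProjectiveSpaceRegular

/-!
# `PalterationThesis` — negative lemmas III: `IsFinite g` is load-bearing in PICover
# (perfection-type radicial covers have no resolution)

Support (negative) lemmas for crux `stmt-ResolutionOfSingularities-0552`
(`Summit.ResolutionOfSingularities.ResolutionOfSingularities.Theses.PAlteration.PalterationThesis`
= `∀ p prime, PIAlt_p ∧ PICover_p`), second conjunct PICover (= route item `Picover`,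
stmt-0554), filed by the standing disprover (cdisprove gen 1; work file
`Cruxes/PalterationThesis/Disproof.lean` §3 bis; companion `LoadBearing.lean`; the sibling crux work file `Cruxes/Picover/Disproof.lean` §2h
records this witness on paper only). This file declares NO definition: the witness ring is Mathlib's
`Subalgebra.perfectClosure 𝔽_p[T] E p` — the `p`-radical closure `𝔽_p[T]^{1/p^∞}` of `𝔽_p[T]`
inside an algebraic closure `E` of `𝔽_p(T)` (the elements of `E` some `p^n`-th power of which
is a polynomial).

* `perfRad_exists_pow_eq` — every element of `𝔽_p[T]^{1/p^∞}` is a `p`-th power;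
  `perfRad_isIntegral`, `perfRad_algebraMap_injective` — it is an integral extension of `𝔽_p[T]`;
  `perfRad_exists_prime_not_mem` — its generic point is not open (lying over a prime `(π)`,
  `π ∤ f^{p^n}`); hence `not_hasResolution_spec_perfRad` — `Spec 𝔽_p[T]^{1/p^∞}` has NO
  resolution (`not_hasResolution_spec_of_forall_exists_pow_eq`: a root-closed domain is
  Noetherian at no non-generic point).
* `universallyInjective_spec_perfRad` — `Spec 𝔽_p[T]^{1/p^∞} → 𝔸¹ = Spec 𝔽_p[T]` is
  universally injective (radicial), by the `K`-points criterion (`tfae_universallyInjective`,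
  Stacks 01S4): two ring maps to a field `K` agreeing on `𝔽_p[T]` agree on `x`, since they agree
  on the polynomial `x^{p^n}` and the iterated Frobenius of `K` (characteristic `p`) is injective;
  `surjective_spec_perfRad` — and surjective (lying over, `Algebra.IsIntegral.comap_surjective`).
* `picover_false_without_isFinite_at` / `picover_false_without_isFinite` — hence **PICover with
  `IsFinite g` dropped is FALSE at every prime**: a universally injective surjection from an
  integral scheme onto the regular integral affine line whose source has no resolution. Any proof
  of `Picover` must use finiteness of the radicial cover (perfection kills Noetherianity; compare
  the route's rank-4 caveat that the Frobenius factorisation is finite iff `[k:k^p] < ∞`).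

## Sources
* The Stacks Project, Tag 01S4 (universally injective = radicial; `K`-points criterion),
  Tag 00FZ (lying over), Tag 02IS (regular).
* M. Artin, *On the joins of Hensel rings*, Adv. Math. 7 (1971) (root-closed / absolutely
  integrally closed rings); the Noetherian-perfect-local-ring-is-a-field argument is folklore and
  is the tree's `not_hasResolution_spec_of_forall_exists_pow_eq`
  (`AbsoluteIntegralClosureNoResolution.lean`).
-/

noncomputable section

open CategoryTheory AlgebraicGeometry TopologicalSpace Topology
open Literature.AlgebraicGeometry.Resolution
open Summit.ResolutionOfSingularities.ResolutionOfSingularities.Theses.PAlteration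

set_option linter.dupNamespace false

namespace Summit.ResolutionOfSingularities.ResolutionOfSingularities.Theorems.PalterationThesis.Negative

section PerfectionWitness

open Polynomial

variable (p : ℕ) [hp : Fact p.Prime]

/-- `𝔽_p[T] → E` is injective, `E` an algebraic closure of `𝔽_p(T)`. (The witness ring below is
the `p`-radical closure `𝔽_p[T]^{1/p^∞}` of `𝔽_p[T]` inside `E`: the elements of `E` some
`p^n`-th power of which is a polynomial — Mathlib's `Subalgebra.perfectClosure 𝔽_p[T] E p`,
written out in full, no new definition.) [folklore] -/
theorem algebraMap_injective_algClosure :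
    Function.Injective (algebraMap (ZMod p)[X] (AlgebraicClosure (RatFunc (ZMod p)))) := by
  rw [IsScalarTower.algebraMap_eq (ZMod p)[X] (RatFunc (ZMod p)) (AlgebraicClosure (RatFunc (ZMod p)))]
  exact (algebraMap (RatFunc (ZMod p)) _).injective.comp (RatFunc.algebraMap_injective (ZMod p))

/-- Every element of `𝔽_p[T]^{1/p^∞}` is a `p`-th power (the `p`-th root in `E` of an element
whose `p^n`-th power is a polynomial has its `p^(n+1)`-th power a polynomial). [folklore] -/
theorem perfRad_exists_pow_eq (a : ↥(Subalgebra.perfectClosure (ZMod p)[X] (AlgebraicClosure (RatFunc (ZMod p))) p)) : ∃ b : ↥(Subalgebra.perfectClosure (ZMod p)[X] (AlgebraicClosure (RatFunc (ZMod p))) p), b ^ p = a := by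
  obtain ⟨z, hz⟩ := IsAlgClosed.exists_pow_nat_eq (a : AlgebraicClosure (RatFunc (ZMod p))) hp.out.pos
  obtain ⟨n, hn⟩ := (Subalgebra.mem_perfectClosure_iff).mp a.2
  refine ⟨⟨z, (Subalgebra.mem_perfectClosure_iff).mpr ⟨n + 1, ?_⟩⟩, Subtype.ext hz⟩
  rw [pow_succ', pow_mul, hz]
  exact hn

/-- `𝔽_p[T] → 𝔽_p[T]^{1/p^∞}` is injective. [folklore] -/
theorem perfRad_algebraMap_injective : Function.Injective (algebraMap (ZMod p)[X] (↥(Subalgebra.perfectClosure (ZMod p)[X] (AlgebraicClosure (RatFunc (ZMod p))) p))) := by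
  intro a b hab
  apply algebraMap_injective_algClosure p
  have := congrArg (fun x : ↥(Subalgebra.perfectClosure (ZMod p)[X] (AlgebraicClosure (RatFunc (ZMod p))) p) => (x : AlgebraicClosure (RatFunc (ZMod p)))) hab
  simpa using this

/-- Every element of `𝔽_p[T]^{1/p^∞}` is integral over `𝔽_p[T]`. [folklore] -/
theorem perfRad_isIntegral (a : ↥(Subalgebra.perfectClosure (ZMod p)[X] (AlgebraicClosure (RatFunc (ZMod p))) p)) : IsIntegral (ZMod p)[X] a := by
  obtain ⟨n, t, ht⟩ := (Subalgebra.mem_perfectClosure_iff).mp a.2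
  have hpow : IsIntegral (ZMod p)[X] (a ^ p ^ n) := by
    have : (a ^ p ^ n : ↥(Subalgebra.perfectClosure (ZMod p)[X] (AlgebraicClosure (RatFunc (ZMod p))) p)) = algebraMap (ZMod p)[X] (↥(Subalgebra.perfectClosure (ZMod p)[X] (AlgebraicClosure (RatFunc (ZMod p))) p)) t := by
      apply Subtype.ext
      simpa using ht.symm
    rw [this]
    exact isIntegral_algebraMap
  exact IsIntegral.of_pow (pow_pos hp.out.pos n) hpow

/-- `𝔽_p[T]^{1/p^∞}` is an integral `𝔽_p[T]`-algebra. [folklore] -/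
theorem perfRad_algebraIsIntegral : Algebra.IsIntegral (ZMod p)[X] (↥(Subalgebra.perfectClosure (ZMod p)[X] (AlgebraicClosure (RatFunc (ZMod p))) p)) :=
  ⟨perfRad_isIntegral p⟩


/-- **The generic point of `Spec 𝔽_p[T]^{1/p^∞}` is not open**: every non-zero `f` avoids some
non-zero prime — a prime lying over `(π)` for an irreducible `π ∈ 𝔽_p[T]` not dividing the
polynomial `f^{p^n}`. [folklore] -/
theorem perfRad_exists_prime_not_mem (f : ↥(Subalgebra.perfectClosure (ZMod p)[X] (AlgebraicClosure (RatFunc (ZMod p))) p)) (hf : f ≠ 0) :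
    ∃ Q : Ideal (↥(Subalgebra.perfectClosure (ZMod p)[X] (AlgebraicClosure (RatFunc (ZMod p))) p)), Q.IsPrime ∧ Q ≠ ⊥ ∧ f ∉ Q := by
  have hinj := perfRad_algebraMap_injective p
  obtain ⟨n, c, hc⟩ := (Subalgebra.mem_perfectClosure_iff).mp f.2
  -- `c = f^(p^n)` as elements of `Rrad`
  have hcf : algebraMap (ZMod p)[X] (↥(Subalgebra.perfectClosure (ZMod p)[X] (AlgebraicClosure (RatFunc (ZMod p))) p)) c = f ^ p ^ n := by
    apply Subtype.ext; simpa using hc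
  have hc0 : c ≠ 0 := by
    intro h0
    rw [h0, map_zero] at hcf
    exact hf (pow_eq_zero_iff (pow_pos hp.out.pos n).ne' |>.mp hcf.symm)
  -- an irreducible `π` not dividing `c`: a factor of `c * X + 1`
  have hdeg : (c * X + 1 : (ZMod p)[X]).natDegree = c.natDegree + 1 := by
    rw [Polynomial.natDegree_add_eq_left_of_natDegree_lt] <;>
      rw [Polynomial.natDegree_mul_X hc0]
    simp
  have hne : (c * X + 1 : (ZMod p)[X]) ≠ 0 := by
    intro h0; rw [h0] at hdeg; simp at hdeg
  have hnu : ¬ IsUnit (c * X + 1 : (ZMod p)[X]) := by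
    intro hu
    have := Polynomial.natDegree_eq_zero_of_isUnit hu
    omega
  obtain ⟨π, hπirr, hπdvd⟩ := WfDvdMonoid.exists_irreducible_factor hnu hne
  have hπc : ¬ π ∣ c := by
    intro hdc
    apply hπirr.not_isUnit
    have : π ∣ (c * X + 1) - c * X := dvd_sub hπdvd (dvd_mul_of_dvd_left hdc _)
    exact isUnit_of_dvd_one (by simpa using this)
  let 𝔭 : Ideal (ZMod p)[X] := Ideal.span {π}
  haveI h𝔭 : 𝔭.IsPrime := (Ideal.span_singleton_prime hπirr.ne_zero).mpr hπirr.prime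
  haveI := perfRad_algebraIsIntegral p
  obtain ⟨Q, -, hQ, hQcomap⟩ := Ideal.exists_ideal_over_prime_of_isIntegral 𝔭
    (⊥ : Ideal (↥(Subalgebra.perfectClosure (ZMod p)[X] (AlgebraicClosure (RatFunc (ZMod p))) p)))
    (by
      intro a ha
      have ha0 : algebraMap (ZMod p)[X] (↥(Subalgebra.perfectClosure (ZMod p)[X] (AlgebraicClosure (RatFunc (ZMod p))) p)) a = 0 :=
        Ideal.mem_bot.mp (Ideal.mem_comap.mp ha)
      have : a = 0 := hinj (by rw [ha0, map_zero])
      rw [this]; exact 𝔭.zero_mem)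
  refine ⟨Q, hQ, ?_, ?_⟩
  · rintro rfl
    have hπmem : π ∈ (⊥ : Ideal (↥(Subalgebra.perfectClosure (ZMod p)[X] (AlgebraicClosure (RatFunc (ZMod p))) p))).comap (algebraMap (ZMod p)[X] _) := by
      rw [hQcomap]; exact Ideal.mem_span_singleton_self π
    have hπ0 : algebraMap (ZMod p)[X] (↥(Subalgebra.perfectClosure (ZMod p)[X] (AlgebraicClosure (RatFunc (ZMod p))) p)) π = 0 :=
      Ideal.mem_bot.mp (Ideal.mem_comap.mp hπmem)
    exact hπirr.ne_zero (hinj (by rw [hπ0, map_zero]))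
  · intro hfQ
    have h1 : algebraMap (ZMod p)[X] _ c ∈ Q := by
      rw [hcf]; exact Q.pow_mem_of_mem hfQ _ (pow_pos hp.out.pos n)
    have h2 : c ∈ 𝔭 := by rw [← hQcomap]; exact h1
    exact hπc (Ideal.mem_span_singleton.mp h2)

/-- **`Spec 𝔽_p[T]^{1/p^∞}` has no resolution of singularities** (root-closed domain with
non-open generic point: `not_hasResolution_spec_of_forall_exists_pow_eq`). [folklore] -/
theorem not_hasResolution_spec_perfRad : ¬ Scheme.HasResolution (Spec (.of (↥(Subalgebra.perfectClosure (ZMod p)[X] (AlgebraicClosure (RatFunc (ZMod p))) p)))) :=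
  not_hasResolution_spec_of_forall_exists_pow_eq (↥(Subalgebra.perfectClosure (ZMod p)[X] (AlgebraicClosure (RatFunc (ZMod p))) p)) hp.out.two_le (perfRad_exists_pow_eq p)
    (perfRad_exists_prime_not_mem p)

/-- **`Spec 𝔽_p[T]^{1/p^∞} → 𝔸¹ = Spec 𝔽_p[T]` is universally injective** (radicial), by the
`K`-points criterion: two ring maps `𝔽_p[T]^{1/p^∞} → K` agreeing on `𝔽_p[T]` agree on `x`
because they agree on the polynomial `x^{p^n}` and `y ↦ y^{p^n}` is injective on the field `K`
of characteristic `p`. [folklore] -/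
theorem universallyInjective_spec_perfRad :
    UniversallyInjective (Spec.map (CommRingCat.ofHom (algebraMap (ZMod p)[X] (↥(Subalgebra.perfectClosure (ZMod p)[X] (AlgebraicClosure (RatFunc (ZMod p))) p))))) := by
  refine ((tfae_universallyInjective
    (Spec.map (CommRingCat.ofHom (algebraMap (ZMod p)[X] (↥(Subalgebra.perfectClosure (ZMod p)[X] (AlgebraicClosure (RatFunc (ZMod p))) p)))))).out 0 1).mpr ?_
  intro K _ g₁ g₂ h
  obtain ⟨φ₁, rfl⟩ := Spec.map_surjective g₁
  obtain ⟨φ₂, rfl⟩ := Spec.map_surjective g₂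
  simp only [← Spec.map_comp] at h
  have h' := congrArg (fun ψ => ψ.hom) (Spec.map_injective h)
  simp only [CommRingCat.hom_comp, CommRingCat.hom_ofHom] at h'
  -- `K` has characteristic `p`
  haveI : CharP K p := by
    have ψ : ZMod p →+* K := φ₁.hom.comp ((algebraMap (ZMod p)[X] (↥(Subalgebra.perfectClosure (ZMod p)[X] (AlgebraicClosure (RatFunc (ZMod p))) p))).comp Polynomial.C)
    exact (ψ.charP_iff_charP p).mp inferInstance
  congr 1
  ext1
  refine RingHom.ext fun x => ?_
  obtain ⟨n, t, ht⟩ := (Subalgebra.mem_perfectClosure_iff).mp x.2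
  have hxt : (x ^ p ^ n : ↥(Subalgebra.perfectClosure (ZMod p)[X] (AlgebraicClosure (RatFunc (ZMod p))) p)) = algebraMap (ZMod p)[X] (↥(Subalgebra.perfectClosure (ZMod p)[X] (AlgebraicClosure (RatFunc (ZMod p))) p)) t := by
    apply Subtype.ext; simpa using ht.symm
  have key : (φ₁.hom x) ^ p ^ n = (φ₂.hom x) ^ p ^ n := by
    rw [← map_pow, ← map_pow, hxt]
    exact congrFun (congrArg DFunLike.coe h') t
  exact (iterateFrobenius K p n).injective (by simpa only [iterateFrobenius_def] using key)

/-- `Spec 𝔽_p[T]^{1/p^∞} → 𝔸¹` is surjective (integral with injective ring map: lying over).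
[folklore] -/
theorem surjective_spec_perfRad :
    Function.Surjective (Spec.map (CommRingCat.ofHom (algebraMap (ZMod p)[X] (↥(Subalgebra.perfectClosure (ZMod p)[X] (AlgebraicClosure (RatFunc (ZMod p))) p))))).base := by
  haveI := perfRad_algebraIsIntegral p
  haveI : FaithfulSMul (ZMod p)[X] (↥(Subalgebra.perfectClosure (ZMod p)[X] (AlgebraicClosure (RatFunc (ZMod p))) p)) :=
    (faithfulSMul_iff_algebraMap_injective _ _).mpr (perfRad_algebraMap_injective p)
  intro y
  obtain ⟨x, hx⟩ := Algebra.IsIntegral.comap_surjective (ZMod p)[X] (↥(Subalgebra.perfectClosure (ZMod p)[X] (AlgebraicClosure (RatFunc (ZMod p))) p)) y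
  exact ⟨x, hx⟩

/-- **PICover with `IsFinite g` dropped is FALSE at every prime**: `Spec 𝔽_p[T]^{1/p^∞} → 𝔸¹`
is universally injective and surjective from an integral scheme onto the regular integral affine
line, but `Spec 𝔽_p[T]^{1/p^∞}` has no resolution — passing to a perfection-type radicial cover
destroys Noetherianity at every closed point. Any proof of PICover must use finiteness of `g`.
[folklore] -/
theorem picover_false_without_isFinite_at :
    ¬ ∀ (k : Type) [Field k] [CharP k p] (Y X : Scheme.{0}) (f : Y ⟶ Spec (.of k)) (g : X ⟶ Y),
        IsSeparated f → LocallyOfFiniteType f → QuasiCompact f → IsIntegral Y →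
          Scheme.IsRegular Y → IsIntegral X → UniversallyInjective g →
            Function.Surjective g.base → Scheme.HasResolution X := by
  intro h
  let f : Spec (.of (ZMod p)[X]) ⟶ Spec (.of (ZMod p)) :=
    Spec.map (CommRingCat.ofHom (algebraMap (ZMod p) (ZMod p)[X]))
  haveI : LocallyOfFiniteType f :=
    (HasRingHomProperty.Spec_iff (P := @LocallyOfFiniteType)).mpr
      (RingHom.finiteType_algebraMap.mpr inferInstance)
  let g : Spec (.of (↥(Subalgebra.perfectClosure (ZMod p)[X] (AlgebraicClosure (RatFunc (ZMod p))) p))) ⟶ Spec (.of (ZMod p)[X]) :=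
    Spec.map (CommRingCat.ofHom (algebraMap (ZMod p)[X] (↥(Subalgebra.perfectClosure (ZMod p)[X] (AlgebraicClosure (RatFunc (ZMod p))) p))))
  exact not_hasResolution_spec_perfRad p
    (h (ZMod p) (Spec (.of (ZMod p)[X])) (Spec (.of (↥(Subalgebra.perfectClosure (ZMod p)[X] (AlgebraicClosure (RatFunc (ZMod p))) p)))) f g inferInstance inferInstance
      inferInstance inferInstance (Scheme.isRegular_Spec (.of (ZMod p)[X])) inferInstance
      (universallyInjective_spec_perfRad p) (surjective_spec_perfRad p))

end PerfectionWitness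

/-- **Any proof of `Picover` must use `IsFinite g`**: the statement with that hypothesis dropped
is false (already at `p = 2`). [folklore] -/
theorem picover_false_without_isFinite :
    ¬ ∀ p : ℕ, p.Prime → ∀ (k : Type) [Field k] [CharP k p] (Y X : Scheme.{0})
        (f : Y ⟶ Spec (.of k)) (g : X ⟶ Y), IsSeparated f → LocallyOfFiniteType f →
          QuasiCompact f → IsIntegral Y → Scheme.IsRegular Y → IsIntegral X →
            UniversallyInjective g → Function.Surjective g.base → Scheme.HasResolution X :=
  fun h =>
  haveI : Fact (Nat.Prime 2) := ⟨Nat.prime_two⟩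
  picover_false_without_isFinite_at 2 (h 2 Nat.prime_two)

end Summit.ResolutionOfSingularities.ResolutionOfSingularities.Theorems.PalterationThesis.Negative

end
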